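import Literature.Barriers.NavierStokesRegularity.NavierStokesInequalityProfilePerturbation
import Literature.Barriers.NavierStokesRegularity.NavierStokesInequalityProfileIntegrals
import Literature.Barriers.NavierStokesRegularity.NavierStokesInequalityPressureScaling
import HarnessLib

/-!
# The profiles `h_{1,t}`, `h_{2,t}` of Ożański's Lemma 4.1 (Scheffer 1985, Lemma 3.1)

Barrier catalogue support file for `NavierStokesRegularity` (D-0021), on the discharge path of
fact D-II `Literature.Barriers.NavierStokesRegularity.NSIProfiles_of_arrangement`
(`NavierStokesInequalityProfiles`). Given a geometric arrangement
(`IsNSIArrangement U₁ U₂ v₁ f₁ φ₁ v₂ f₂ φ₂ T τ z`; W. S. Ożański, arXiv:1709.00602v4, §4,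
(4.1)–(4.3)), Lemma 4.1 (held plain-text rendering: Lemma 8; Scheffer, Comm. Math. Phys. 101
(1985), Lemma 3.1 with (3.8)–(3.15)) provides `δ > 0` and the time-dependent modifications

  `h²_{1,t} = f₁² - 2tδφ₁`,  `h²_{2,t} = f₂² - 2tδφ₂ + ∫₀ᵗ v₂·F[v₁,h_{1,s}] ds`   ((4.9))

of `f₁, f₂`, smooth, with `(vᵢ, h_{i,t}, φᵢ)` structures on `Uᵢ` for `t ∈ (-δ, T+δ)` ((4.10)) and
the gain `h²_{2,T}(y) > τ⁻²(f₁(R⁻¹x) + f₂(R⁻¹x))² + θ`, `y = R⁻¹(Γx)`, `x ∈ G` ((4.11), with the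
margin `θ > 0` of (4.8) extracted from the strict inequality (4.2) by compactness of `G`).

This file CONSTRUCTS these objects and PROVES Lemma 4.1 for the tree's rendering:

* `hProfile₁ f₁ φ₁ δ κ t = dampedProfile f₁ φ₁ δ (κ t) = √(f₁² - 2κ(t)δφ₁)` (the tree's damped
  profile of `NavierStokesInequalityDampedProfile`, with its time run through a clamp),
  `interactionRate … s = v₂·F[v₁,h_{1,s}]`,
  `hRadicand₂ … t = f₂² - 2κ(t)δφ₂ + ∫₀^{κ(t)} v₂·F[v₁,h_{1,s}] ds`, `hProfile₂ = √(hRadicand₂)`: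
  (4.9) with the time composed with a smooth clamp `κ` (`κ = id` on `[0,T]`,
  `κ(ℝ) ⊆ [-ε, T+ε]`, `exists_smooth_clamp`), so that the families are defined and smooth for all
  `t ∈ ℝ` and every property of Lemma 4.1 holds for every real time (Ożański: "by continuity …
  this property holds also for `t` belonging to an open interval containing `[0,T]`. Taking `δ`
  smaller we can take this open interval to be `(-δ, T+δ)`"); nothing changes on `[0,T]`;
* `IsHProfileData` — the conclusions of Lemma 4.1 packaged for the sequel (§4.1–4.2): `δ > 0`,
  the clamp, the gaps `fᵢ² - 2tδφᵢ - |vᵢ|² ≥ mᵢ` (`exists_dampedProfile_gap`) and the structure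
  criteria of `NavierStokesInequalityProfilePerturbation` (`DampedCriterion`) on the whole time
  range `[-1, T+1]` met by `h_{i,t}` and `qᵏ_{i,t}`, the core inequality `h_{2,t} > |v₂|` on
  `{φ₂ = 1}` ((4.10) for `i = 2`, the only non-automatic one), and the gain (4.11) with its `θ`;
* `IsNSIArrangement.exists_hProfileData` — **Lemma 4.1**: every arrangement admits such data;
* the API under `IsHProfileData`: joint smoothness of `h₁, h₂`, `(b vᵢ, h_{i,t}, ψᵢ)` structures
  for all `t` and `|b| ≤ 1` ((4.13)), the identities (4.9) for the squares, `h_{i,t} = fᵢ` off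
  `supp φᵢ`, and the smoothness of the interaction rate.

## The printed proof and its rendering

Ożański: for `h₁`, `δ < min_{supp φ₁}|f₁² - |v₁|²|/2(T+2)` gives `h_{1,t} > |v₁|` on `supp φ₁`
(`IsNSIStructure.exists_dampedProfile_gap` of `NavierStokesInequalityDampedProfile`); for `h₂`, "suppose for the moment that `δ = 0`. Then
`h_{1,t} = f₁` and so `h²_{2,t} = f₂² + t v₂·F[v₁,f₁]`", which exceeds `|v₂|²` on `supp φ₂` for
`t ∈ [0,T]` by (4.1) at `t = T`, Definition 3.3 at `t = 0` and linearity in `t`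
(`exists_interaction_gap`); "since `h₂` depends continuously on `δ`" — here quantitatively:
`|h²_{2,t} - (f₂² - 2tδφ₂ + t v₂·F[v₁,f₁])| ≤ δ C₀` by the first lemma of Appendix A.3 (the tree's
`exists_planePressure_sub_le`, applied to the pairs `(v₁,h_{1,s})`/`(v₁,f₁)` and
`(0,h_{1,s})`/`(0,f₁)`, whose squares differ by `-2sδφ₁`, `abs_hRadicand₂_sub_le`) — "we obtain
`h_{2,t} > |v₂|` in `supp φ₂` for `t ∈ [0,T]` if `δ > 0` is sufficiently small", and (4.11) the same
way from (4.8). The condition `Lh > 0` off `{φ = 1}` of Definition 3.3 is handled by the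
perturbation criterion (positivity of `L` on `supp φ ∩ {φ ≤ 1/4}`, cut-off `ψ = 1` on `{φ ≥ 1/4}`).

## References

* W. S. Ożański, *On weak solutions to the Navier–Stokes inequality with internal
  singularities*, arXiv:1709.00602v4, §4: (4.1)–(4.3), (4.8), Lemma 4.1 ((4.9)–(4.11)) and its
  proof, (4.13). [`Ozanski2017NSISingular`]
* V. Scheffer, *A solution to the Navier–Stokes inequality with an internal singularity*,
  Comm. Math. Phys. 101 (1985), 47–85: Lemma 3.1, (3.8)–(3.15). [`Scheffer1985`]
-/

noncomputable section

open Set Function Filter Topology Metric MeasureTheory intervalIntegral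
open scoped ContDiff

namespace Literature.Barriers.NavierStokesRegularity

open Literature.Analysis.FluidPDE

-- nested operator types `ℝ² →L[ℝ] ℝ² →L[ℝ] ℝ` (second derivatives)
set_option maxSynthPendingDepth 3

/-- Local notation for physical space `ℝ³ = EuclideanSpace ℝ (Fin 3)`. -/
local notation "ℝ³" => EuclideanSpace ℝ (Fin 3)

/-! ### The objects of Lemma 4.1 -/

/-- **`h_{1,t} = √(f₁² - 2κ(t)δφ₁)`** — the damped profile `dampedProfile f₁ φ₁ δ` of the tree
(Ożański (4.9), first line; Scheffer (3.12)) with the time run through a clamp `κ` (`κ(t) = t` on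
`[0,T]`). [cite: Ozanski2017NSISingular, Lemma 4.1 (4.9)] [cite: Scheffer1985, Lemma 3.1 (3.12)] -/
def hProfile₁ (f₁ φ₁ : ℝ × ℝ → ℝ) (δ : ℝ) (κ : ℝ → ℝ) (t : ℝ) (q : ℝ × ℝ) : ℝ :=
  dampedProfile f₁ φ₁ δ (κ t) q

/-- **The interaction rate `v₂·F[v₁,h_{1,s}]`** — the integrand of (4.9), second line (Scheffer
(3.13): `-v₂·∇(p[v₁,h₁,ᵣ] - p[0,h₁,ᵣ])`). [cite: Ozanski2017NSISingular, Lemma 4.1 (4.9)]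
[cite: Scheffer1985, Lemma 3.1 (3.13)] -/
def interactionRate (v₁ v₂ : ℝ × ℝ → ℝ × ℝ) (f₁ φ₁ : ℝ × ℝ → ℝ) (δ : ℝ) (κ : ℝ → ℝ) (s : ℝ)
    (q : ℝ × ℝ) : ℝ :=
  (v₂ q).1 * (pressureInteraction v₁ (hProfile₁ f₁ φ₁ δ κ s) q).1 +
    (v₂ q).2 * (pressureInteraction v₁ (hProfile₁ f₁ φ₁ δ κ s) q).2

/-- **`h²_{2,t} = f₂² - 2κ(t)δφ₂ + ∫₀^{κ(t)} v₂·F[v₁,h_{1,s}] ds`** (Ożański (4.9), second line;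
Scheffer (3.13)), the radicand of `h_{2,t}`.
[cite: Ozanski2017NSISingular, Lemma 4.1 (4.9)] [cite: Scheffer1985, Lemma 3.1 (3.13)] -/
def hRadicand₂ (v₁ v₂ : ℝ × ℝ → ℝ × ℝ) (f₁ φ₁ f₂ φ₂ : ℝ × ℝ → ℝ) (δ : ℝ) (κ : ℝ → ℝ) (t : ℝ)
    (q : ℝ × ℝ) : ℝ :=
  f₂ q ^ 2 - 2 * κ t * δ * φ₂ q + ∫ s in (0 : ℝ)..κ t, interactionRate v₁ v₂ f₁ φ₁ δ κ s q

/-- **`h_{2,t} = √(h²_{2,t})`** (Ożański (4.9); Scheffer (3.13)).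
[cite: Ozanski2017NSISingular, Lemma 4.1 (4.9)] [cite: Scheffer1985, Lemma 3.1 (3.13)] -/
def hProfile₂ (v₁ v₂ : ℝ × ℝ → ℝ × ℝ) (f₁ φ₁ f₂ φ₂ : ℝ × ℝ → ℝ) (δ : ℝ) (κ : ℝ → ℝ) (t : ℝ)
    (q : ℝ × ℝ) : ℝ :=
  Real.sqrt (hRadicand₂ v₁ v₂ f₁ φ₁ f₂ φ₂ δ κ t q)

/-- `r ≤ (√r)²` for every real `r` (equality for `r ≥ 0`). [folklore] -/
theorem le_sqrt_sq (r : ℝ) : r ≤ Real.sqrt r ^ 2 := by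
  rcases le_or_gt 0 r with h | h
  · rw [Real.sq_sqrt h]
  · exact h.le.trans (sq_nonneg _)

/-! ### The structure criterion of `NavierStokesInequalityProfilePerturbation`, as a predicate -/

/-- The conclusion of `IsNSIStructure.exists_perturbed_structure` for a structure `(v,f,φ)` on
`U`, a cut-off `ψ`, a slack `δ` and a horizon `T`: for every `t ∈ [-1,T+1]`, every smooth
`g ≥ 0` equal to the damped profile `√(f² - 2tδφ)` on `{φ < 1}` with `g > |v|` on `{φ = 1}` gives
structures `(bv, g, ψ)`, `|b| ≤ 1`, with `Lg ≥ 0` on `{φ < 1/4}` etc.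
[cite: Ozanski2017NSISingular, §4 (4.15) and (4.20)] -/
def DampedCriterion (U : Set (ℝ × ℝ)) (v : ℝ × ℝ → ℝ × ℝ) (f φ ψ : ℝ × ℝ → ℝ) (δ T : ℝ) : Prop :=
  ∀ t ∈ Icc (-1 : ℝ) (T + 1), ∀ g : ℝ × ℝ → ℝ, ContDiff ℝ ∞ g → (∀ q, 0 ≤ g q) →
    (∀ q, φ q < 1 → g q = dampedProfile f φ δ t q) →
    (∀ q, φ q = 1 → (v q).1 ^ 2 + (v q).2 ^ 2 < g q ^ 2) →
    (∀ b : ℝ, |b| ≤ 1 → IsNSIStructure U (b • v) g ψ) ∧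
      (∀ q, φ q < 1 / 4 → 0 ≤ opL g q) ∧
      (∀ q ∈ tsupport φ, φ q ≤ 1 / 4 → 0 < opL g q) ∧
      (∀ q ∈ U, 0 < g q) ∧ (∀ q ∉ closure U, g q = 0) ∧
      (∀ q ∉ tsupport φ, g q = f q)

/-- The criterion holds for all `δ ∈ [0, δ₀]`, for every structure and horizon
(`IsNSIStructure.exists_perturbed_structure`). [cite: Ozanski2017NSISingular, §4 (4.15) and (4.20)] -/
theorem IsNSIStructure.exists_dampedCriterion {U : Set (ℝ × ℝ)} {v : ℝ × ℝ → ℝ × ℝ}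
    {f φ : ℝ × ℝ → ℝ} (h : IsNSIStructure U v f φ) {T : ℝ} (hT : 0 < T) :
    ∃ δ₀ > 0, ∃ ψ : ℝ × ℝ → ℝ, ∀ δ ∈ Icc (0 : ℝ) δ₀, DampedCriterion U v f φ ψ δ T := by
  obtain ⟨δ₀, hδ₀, ψ, -, hψ⟩ := h.exists_perturbed_structure hT
  exact ⟨δ₀, hδ₀, ψ, fun δ hδ t ht => hψ δ hδ t ht⟩

/-! ### `h₁`: squares, smoothness, structures -/

section H1

variable {U₁ : Set (ℝ × ℝ)} {v₁ : ℝ × ℝ → ℝ × ℝ} {f₁ φ₁ ψ₁ : ℝ × ℝ → ℝ} {δ T : ℝ} {κ : ℝ → ℝ}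
  {m₁ : ℝ}

/-- Unfolding `hProfile₁`. [folklore] -/
theorem hProfile₁_apply (f₁ φ₁ : ℝ × ℝ → ℝ) (δ : ℝ) (κ : ℝ → ℝ) (t : ℝ) (q : ℝ × ℝ) :
    hProfile₁ f₁ φ₁ δ κ t q = dampedProfile f₁ φ₁ δ (κ t) q := rfl

/-- The slice of `h₁` at time `t` is the damped profile at time `κ(t)`. [folklore] -/
theorem hProfile₁_eq (f₁ φ₁ : ℝ × ℝ → ℝ) (δ : ℝ) (κ : ℝ → ℝ) (t : ℝ) :
    hProfile₁ f₁ φ₁ δ κ t = dampedProfile f₁ φ₁ δ (κ t) := rfl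

/-- `h_{1,t} ≥ 0`. [cite: Ozanski2017NSISingular, Lemma 4.1] -/
theorem hProfile₁_nonneg (f₁ φ₁ : ℝ × ℝ → ℝ) (δ : ℝ) (κ : ℝ → ℝ) (t : ℝ) (q : ℝ × ℝ) :
    0 ≤ hProfile₁ f₁ φ₁ δ κ t q :=
  dampedProfile_nonneg _ _ _ _ _

/-- **(4.9): `h²_{1,t} = f₁² - 2κ(t)δφ₁` everywhere**, when the clamped times stay in
`[-1,T+1]`, the range of the gap (radicand `≥ m₁ > 0` on `supp φ₁`, `= f₁² ≥ 0` off it).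
[cite: Ozanski2017NSISingular, Lemma 4.1 (4.9)] -/
theorem hProfile₁_sq
    (hgap : ∀ t ∈ Icc (-1 : ℝ) (T + 1), ∀ q ∈ tsupport φ₁,
      (v₁ q).1 ^ 2 + (v₁ q).2 ^ 2 + m₁ ≤ f₁ q ^ 2 - 2 * t * δ * φ₁ q)
    (hm₁ : 0 < m₁) (hκ : ∀ t, κ t ∈ Icc (-1 : ℝ) (T + 1)) (t : ℝ) (q : ℝ × ℝ) :
    hProfile₁ f₁ φ₁ δ κ t q ^ 2 = f₁ q ^ 2 - 2 * κ t * δ * φ₁ q := by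
  rw [hProfile₁, dampedProfile_apply, Real.sq_sqrt]
  by_cases hq : q ∈ tsupport φ₁
  · have := hgap (κ t) (hκ t) q hq
    nlinarith [sq_nonneg (v₁ q).1, sq_nonneg (v₁ q).2]
  · rw [image_eq_zero_of_notMem_tsupport hq, mul_zero, sub_zero]
    exact sq_nonneg _

/-- **`h_{1,t} > |v₁|` on `supp φ₁`** (in particular on `{φ₁ = 1}`), by the gap.
[cite: Ozanski2017NSISingular, Lemma 4.1 (proof)] -/
theorem sq_lt_hProfile₁_sq
    (hgap : ∀ t ∈ Icc (-1 : ℝ) (T + 1), ∀ q ∈ tsupport φ₁,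
      (v₁ q).1 ^ 2 + (v₁ q).2 ^ 2 + m₁ ≤ f₁ q ^ 2 - 2 * t * δ * φ₁ q)
    (hm₁ : 0 < m₁) (hκ : ∀ t, κ t ∈ Icc (-1 : ℝ) (T + 1)) (t : ℝ) {q : ℝ × ℝ}
    (hq : q ∈ tsupport φ₁) :
    (v₁ q).1 ^ 2 + (v₁ q).2 ^ 2 < hProfile₁ f₁ φ₁ δ κ t q ^ 2 := by
  rw [hProfile₁_sq hgap hm₁ hκ]
  have := hgap (κ t) (hκ t) q hq
  linarith

/-- **`h₁` is jointly smooth on `ℝ × ℝ²`**: the damped profile is smooth on `(-1,T+1) × ℝ²`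
(`exists_contDiffOn_dampedProfile`) and the clamp keeps the time inside.
[cite: Ozanski2017NSISingular, Lemma 4.1] -/
theorem contDiff_hProfile₁
    (hsm : ContDiffOn ℝ ∞ (uncurry (dampedProfile f₁ φ₁ δ)) (Ioo (-1 : ℝ) (T + 1) ×ˢ univ))
    (hκs : ContDiff ℝ ∞ κ) (hκo : ∀ t, κ t ∈ Ioo (-1 : ℝ) (T + 1)) :
    ContDiff ℝ ∞ (uncurry (hProfile₁ f₁ φ₁ δ κ)) :=
  hsm.comp_contDiff ((hκs.comp contDiff_fst).prodMk contDiff_snd) fun p => ⟨hκo p.1, mem_univ _⟩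

/-- **`(bv₁, h_{1,t}, ψ₁)` is a structure on `U₁` for every `t` and `|b| ≤ 1`** ((4.10), (4.13) for
`i = 1`), by the perturbation criterion at the clamped time. [cite: Ozanski2017NSISingular, Lemma 4.1 (4.10) and (4.13)] -/
theorem isNSIStructure_hProfile₁ (hcrit : DampedCriterion U₁ v₁ f₁ φ₁ ψ₁ δ T)
    (hgap : ∀ t ∈ Icc (-1 : ℝ) (T + 1), ∀ q ∈ tsupport φ₁,
      (v₁ q).1 ^ 2 + (v₁ q).2 ^ 2 + m₁ ≤ f₁ q ^ 2 - 2 * t * δ * φ₁ q)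
    (hm₁ : 0 < m₁) (hh₁ : ContDiff ℝ ∞ (uncurry (hProfile₁ f₁ φ₁ δ κ)))
    (hκ : ∀ t, κ t ∈ Icc (-1 : ℝ) (T + 1)) (t : ℝ) {b : ℝ} (hb : |b| ≤ 1) :
    IsNSIStructure U₁ (b • v₁) (hProfile₁ f₁ φ₁ δ κ t) ψ₁ :=
  (hcrit (κ t) (hκ t) _ (hh₁.slice_param t) (hProfile₁_nonneg f₁ φ₁ δ κ t) (fun _ _ => rfl)
    (fun _ hq => sq_lt_hProfile₁_sq hgap hm₁ hκ t (mem_tsupport_of_eq_one hq))).1 b hb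

end H1

/-! ### Smooth families of planar pressures and the interaction rate -/

section Family

variable {U : Set (ℝ × ℝ)} {v : ℝ × ℝ → ℝ × ℝ} {f φ : ℝ × ℝ → ℝ}

/-- **`(t,q) ↦ p[bv, Q(t)](q)` is jointly `C^∞` on `ℝ × ℝ²`** for a constant direction factor
`|b| ≤ 1` and a globally smooth admissible family `Q` (the tree's
`contDiffOn_planePressure_param` on `S = ℝ`). [cite: Ozanski2017NSISingular, §4.1 (4.16) and (3.21)] -/
theorem contDiff_planePressure_family (hS : IsNSIStructure U v f φ) {b : ℝ} (hb : |b| ≤ 1)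
    {Q : ℝ → ℝ × ℝ → ℝ} (hQ : ContDiff ℝ ∞ (uncurry Q)) (hQ0 : ∀ t q, 0 ≤ Q t q)
    (hQz : ∀ t, ∀ q ∉ closure U, Q t q = 0)
    (hQv : ∀ t, ∀ q ∈ U, (v q).1 ^ 2 + (v q).2 ^ 2 < Q t q ^ 2) :
    ContDiff ℝ ∞ (uncurry fun t q => planePressure (b • v) (Q t) q) := by
  have h := contDiffOn_planePressure_param (S := univ) (a := fun _ => b) (Q := Q) isOpen_univ
    hS.isCompact_closure hS.closure_subset hS.v_smooth hS.tsupport_v_subset contDiff_const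
    (fun _ => hb) hQ.contDiffOn (fun t _ q => hQ0 t q) (fun t _ q hq => hQz t q hq)
    (fun t _ q hq => hQv t q hq)
  rwa [univ_prod_univ, contDiffOn_univ] at h

/-- `(t,q) ↦ ∂ᵣ p[bv, Q(t)](q)` is jointly `C^∞`. [cite: Ozanski2017NSISingular, §4.1 (4.16)] -/
theorem contDiff_derivR_planePressure_family (hS : IsNSIStructure U v f φ) {b : ℝ} (hb : |b| ≤ 1)
    {Q : ℝ → ℝ × ℝ → ℝ} (hQ : ContDiff ℝ ∞ (uncurry Q)) (hQ0 : ∀ t q, 0 ≤ Q t q)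
    (hQz : ∀ t, ∀ q ∉ closure U, Q t q = 0)
    (hQv : ∀ t, ∀ q ∈ U, (v q).1 ^ 2 + (v q).2 ^ 2 < Q t q ^ 2) :
    ContDiff ℝ ∞ fun p : ℝ × (ℝ × ℝ) => derivR (planePressure (b • v) (Q p.1)) p.2 :=
  (contDiff_planePressure_family hS hb hQ hQ0 hQz hQv).derivR_param
    (P := fun t q => planePressure (b • v) (Q t) q)

/-- `(t,q) ↦ ∂_z p[bv, Q(t)](q)` is jointly `C^∞`. [cite: Ozanski2017NSISingular, §4.1 (4.16)] -/
theorem contDiff_derivZ_planePressure_family (hS : IsNSIStructure U v f φ) {b : ℝ} (hb : |b| ≤ 1)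
    {Q : ℝ → ℝ × ℝ → ℝ} (hQ : ContDiff ℝ ∞ (uncurry Q)) (hQ0 : ∀ t q, 0 ≤ Q t q)
    (hQz : ∀ t, ∀ q ∉ closure U, Q t q = 0)
    (hQv : ∀ t, ∀ q ∈ U, (v q).1 ^ 2 + (v q).2 ^ 2 < Q t q ^ 2) :
    ContDiff ℝ ∞ fun p : ℝ × (ℝ × ℝ) => derivZ (planePressure (b • v) (Q p.1)) p.2 :=
  (contDiff_planePressure_family hS hb hQ hQ0 hQz hQv).derivZ_param
    (P := fun t q => planePressure (b • v) (Q t) q)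

/-- **`(t,q) ↦ F[v, Q(t)](q)` is jointly `C^∞`** (`F = ∇p[0,·] - ∇p[v,·]`, (3.34)).
[cite: Ozanski2017NSISingular, §3.6 (3.34) and §4.1] -/
theorem contDiff_pressureInteraction_family (hS : IsNSIStructure U v f φ)
    {Q : ℝ → ℝ × ℝ → ℝ} (hQ : ContDiff ℝ ∞ (uncurry Q)) (hQ0 : ∀ t q, 0 ≤ Q t q)
    (hQz : ∀ t, ∀ q ∉ closure U, Q t q = 0)
    (hQv : ∀ t, ∀ q ∈ U, (v q).1 ^ 2 + (v q).2 ^ 2 < Q t q ^ 2) :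
    ContDiff ℝ ∞ fun p : ℝ × (ℝ × ℝ) => pressureInteraction v (Q p.1) p.2 := by
  have h0R := contDiff_derivR_planePressure_family hS (b := 0) (by norm_num) hQ hQ0 hQz hQv
  have h0Z := contDiff_derivZ_planePressure_family hS (b := 0) (by norm_num) hQ hQ0 hQz hQv
  have h1R := contDiff_derivR_planePressure_family hS (b := 1) (by norm_num) hQ hQ0 hQz hQv
  have h1Z := contDiff_derivZ_planePressure_family hS (b := 1) (by norm_num) hQ hQ0 hQz hQv
  simp only [zero_smul, one_smul] at h0R h0Z h1R h1Z
  exact (h0R.sub h1R).prodMk (h0Z.sub h1Z)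

end Family

/-! ### `h₂`: the interaction rate, the radicand, smoothness -/

section H2

variable {U₁ U₂ : Set (ℝ × ℝ)} {v₁ v₂ : ℝ × ℝ → ℝ × ℝ} {f₁ φ₁ f₂ φ₂ ψ₁ ψ₂ : ℝ × ℝ → ℝ}
  {δ T : ℝ} {κ : ℝ → ℝ} {m₁ : ℝ}

/-- The interaction rate vanishes where `v₂` does (in particular on `{φ₂ < 1}`). [folklore] -/
theorem interactionRate_eq_zero {s : ℝ} {q : ℝ × ℝ} (hq : v₂ q = 0) :
    interactionRate v₁ v₂ f₁ φ₁ δ κ s q = 0 := by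
  simp [interactionRate, hq]

/-- **The interaction rate `(s,q) ↦ v₂·F[v₁,h_{1,s}]` is jointly `C^∞`** (smooth `v₂`, and
`F[v₁,h_{1,s}]` jointly smooth along the admissible family `h₁`).
[cite: Ozanski2017NSISingular, Lemma 4.1 (4.9)] -/
theorem contDiff_interactionRate (h₁S : IsNSIStructure U₁ v₁ f₁ φ₁) (hv₂ : ContDiff ℝ ∞ v₂)
    (hh : ContDiff ℝ ∞ (uncurry (hProfile₁ f₁ φ₁ δ κ)))
    (hstr : ∀ t, IsNSIStructure U₁ v₁ (hProfile₁ f₁ φ₁ δ κ t) ψ₁) :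
    ContDiff ℝ ∞ (uncurry (interactionRate v₁ v₂ f₁ φ₁ δ κ)) := by
  have hF := contDiff_pressureInteraction_family h₁S hh (fun t q => hProfile₁_nonneg _ _ _ _ t q)
    (fun t q hq => (hstr t).f_eq_zero hq) (fun t q hq => (hstr t).sq_lt q hq)
  have hv := hv₂.comp contDiff_snd (f := fun p : ℝ × (ℝ × ℝ) => p.2)
  exact ((contDiff_fst.comp hv).mul (contDiff_fst.comp hF)).add
    ((contDiff_snd.comp hv).mul (contDiff_snd.comp hF))

/-- **The radicand `(t,q) ↦ h²_{2,t}(q)` is jointly `C^∞`.** [cite: Ozanski2017NSISingular, Lemma 4.1] -/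
theorem contDiff_hRadicand₂ (hf₂ : ContDiff ℝ ∞ f₂) (hφ₂ : ContDiff ℝ ∞ φ₂) (hκs : ContDiff ℝ ∞ κ)
    (hΓ : ContDiff ℝ ∞ (uncurry (interactionRate v₁ v₂ f₁ φ₁ δ κ))) :
    ContDiff ℝ ∞ (uncurry (hRadicand₂ v₁ v₂ f₁ φ₁ f₂ φ₂ δ κ)) := by
  have hI := contDiff_primitive_param hΓ
  have hJ : ContDiff ℝ ∞ fun p : ℝ × (ℝ × ℝ) =>
      ∫ s in (0 : ℝ)..κ p.1, interactionRate v₁ v₂ f₁ φ₁ δ κ s p.2 :=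
    hI.comp ((hκs.comp contDiff_fst).prodMk contDiff_snd)
  have h1 : ContDiff ℝ ∞ fun p : ℝ × (ℝ × ℝ) => f₂ p.2 ^ 2 - 2 * κ p.1 * δ * φ₂ p.2 :=
    ((hf₂.comp contDiff_snd).pow 2).sub
      (((contDiff_const.mul (hκs.comp contDiff_fst)).mul contDiff_const).mul (hφ₂.comp contDiff_snd))
  exact h1.add hJ

/-- Where `v₂ = 0` the radicand is `f₂² - 2κ(t)δφ₂`. [folklore] -/
theorem hRadicand₂_of_v₂_eq_zero {t : ℝ} {q : ℝ × ℝ} (hq : v₂ q = 0) :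
    hRadicand₂ v₁ v₂ f₁ φ₁ f₂ φ₂ δ κ t q = f₂ q ^ 2 - 2 * κ t * δ * φ₂ q := by
  have : (fun s => interactionRate v₁ v₂ f₁ φ₁ δ κ s q) = fun _ => 0 :=
    funext fun s => interactionRate_eq_zero hq
  rw [hRadicand₂, this, intervalIntegral.integral_zero, add_zero]

/-- **On `{φ₂ < 1}` the profile `h_{2,t}` is the damped profile `√(f₂² - 2κ(t)δφ₂)`**
(`v₂ = 0` there). [cite: Ozanski2017NSISingular, Lemma 4.1 (4.9)] -/
theorem hProfile₂_eq_dampedProfile (h₂S : IsNSIStructure U₂ v₂ f₂ φ₂) (t : ℝ) {q : ℝ × ℝ}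
    (hq : φ₂ q < 1) :
    hProfile₂ v₁ v₂ f₁ φ₁ f₂ φ₂ δ κ t q = dampedProfile f₂ φ₂ δ (κ t) q := by
  rw [hProfile₂, hRadicand₂_of_v₂_eq_zero (h₂S.v_eq_zero_of_lt hq), dampedProfile_apply]

/-- `h_{2,t} ≥ 0`. [cite: Ozanski2017NSISingular, Lemma 4.1] -/
theorem hProfile₂_nonneg (t : ℝ) (q : ℝ × ℝ) : 0 ≤ hProfile₂ v₁ v₂ f₁ φ₁ f₂ φ₂ δ κ t q :=
  Real.sqrt_nonneg _

/-- **`h₂` is jointly smooth on `ℝ × ℝ²`** once the radicand is positive on `ℝ × U₂` (on `U₂` the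
square root of a positive smooth function, off `supp φ₂` equal to `f₂`).
[cite: Ozanski2017NSISingular, Lemma 4.1] -/
theorem contDiff_hProfile₂ (h₂S : IsNSIStructure U₂ v₂ f₂ φ₂)
    (hR : ContDiff ℝ ∞ (uncurry (hRadicand₂ v₁ v₂ f₁ φ₁ f₂ φ₂ δ κ)))
    (hpos : ∀ t, ∀ q ∈ U₂, 0 < hRadicand₂ v₁ v₂ f₁ φ₁ f₂ φ₂ δ κ t q) :
    ContDiff ℝ ∞ (uncurry (hProfile₂ v₁ v₂ f₁ φ₁ f₂ φ₂ δ κ)) := by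
  refine contDiff_iff_contDiffAt.2 fun p => ?_
  rcases p with ⟨t, q⟩
  by_cases hq : q ∈ tsupport φ₂
  · exact hR.contDiffAt.sqrt (hpos t q (h₂S.tsupport_φ hq)).ne'
  · have hO : IsOpen ((univ : Set ℝ) ×ˢ (tsupport φ₂)ᶜ) :=
      isOpen_univ.prod (isClosed_tsupport φ₂).isOpen_compl
    have hev : uncurry (hProfile₂ v₁ v₂ f₁ φ₁ f₂ φ₂ δ κ) =ᶠ[𝓝 (t, q)]
        fun p : ℝ × (ℝ × ℝ) => f₂ p.2 := by
      filter_upwards [hO.mem_nhds ⟨mem_univ _, hq⟩] with p hp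
      have hφ0 : φ₂ p.2 = 0 := image_eq_zero_of_notMem_tsupport hp.2
      simp only [uncurry]
      rw [hProfile₂_eq_dampedProfile h₂S p.1 (by rw [hφ0]; norm_num),
        h₂S.dampedProfile_eq_of_notMem δ _ hp.2]
    exact (h₂S.f_smooth.comp contDiff_snd).contDiffAt.congr_of_eventuallyEq hev

/-- **`(bv₂, h_{2,t}, ψ₂)` is a structure on `U₂` for every `t` and `|b| ≤ 1`** ((4.10), (4.13) for
`i = 2`), by the perturbation criterion, GIVEN the core inequality `h_{2,t} > |v₂|` on `{φ₂ = 1}`.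
[cite: Ozanski2017NSISingular, Lemma 4.1 (4.10) and (4.13)] -/
theorem isNSIStructure_hProfile₂ (h₂S : IsNSIStructure U₂ v₂ f₂ φ₂)
    (hcrit : DampedCriterion U₂ v₂ f₂ φ₂ ψ₂ δ T) (hκ : ∀ t, κ t ∈ Icc (-1 : ℝ) (T + 1))
    (hh₂ : ContDiff ℝ ∞ (uncurry (hProfile₂ v₁ v₂ f₁ φ₁ f₂ φ₂ δ κ)))
    (hcore : ∀ t q, φ₂ q = 1 →
      (v₂ q).1 ^ 2 + (v₂ q).2 ^ 2 < hProfile₂ v₁ v₂ f₁ φ₁ f₂ φ₂ δ κ t q ^ 2)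
    (t : ℝ) {b : ℝ} (hb : |b| ≤ 1) :
    IsNSIStructure U₂ (b • v₂) (hProfile₂ v₁ v₂ f₁ φ₁ f₂ φ₂ δ κ t) ψ₂ :=
  (hcrit (κ t) (hκ t) _ (hh₂.slice_param t) (hProfile₂_nonneg t)
    (fun _ hq => hProfile₂_eq_dampedProfile h₂S t hq) (hcore t)).1 b hb

end H2

/-! ### Lemma 4.1, the estimates: `h²_{2,t}` versus `f₂² - 2tδφ₂ + t v₂·F[v₁,f₁]` -/

section Estimates

variable {U₁ U₂ : Set (ℝ × ℝ)} {v₁ v₂ : ℝ × ℝ → ℝ × ℝ} {f₁ φ₁ f₂ φ₂ ψ₁ : ℝ × ℝ → ℝ}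
  {δ T : ℝ} {κ : ℝ → ℝ} {m₁ : ℝ}

/-- A smooth compactly supported planar function has bounded first and second derivatives.
[folklore] -/
theorem exists_fderiv_bounds {φ : ℝ × ℝ → ℝ} (hφ : ContDiff ℝ ∞ φ) (hc : HasCompactSupport φ) :
    ∃ B₁ B₂ : ℝ, 0 ≤ B₁ ∧ 0 ≤ B₂ ∧ (∀ q, ‖fderiv ℝ φ q‖ ≤ B₁) ∧
      ∀ q, ‖fderiv ℝ (fderiv ℝ φ) q‖ ≤ B₂ := by
  have hD : ContDiff ℝ ∞ (fderiv ℝ φ) := hφ.fderiv_right (m := ∞) (by simp)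
  obtain ⟨B₁, hB₁⟩ := (hc.fderiv (𝕜 := ℝ)).exists_bound_of_continuous (hφ.continuous_fderiv (by simp))
  obtain ⟨B₂, hB₂⟩ := ((hc.fderiv (𝕜 := ℝ)).fderiv (𝕜 := ℝ)).exists_bound_of_continuous
    (hD.continuous_fderiv (by simp))
  exact ⟨max B₁ 0, max B₂ 0, le_max_right _ _, le_max_right _ _,
    fun q => (hB₁ q).trans (le_max_left _ _), fun q => (hB₂ q).trans (le_max_left _ _)⟩

/-- `h²_{1,s} - f₁² = -2κ(s)δ φ₁` has derivatives bounded by `|2κ(s)δ|` times those of `φ₁`. [folklore] -/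
theorem fderiv_hProfile₁_sq_sub
    (hgap : ∀ t ∈ Icc (-1 : ℝ) (T + 1), ∀ q ∈ tsupport φ₁,
      (v₁ q).1 ^ 2 + (v₁ q).2 ^ 2 + m₁ ≤ f₁ q ^ 2 - 2 * t * δ * φ₁ q)
    (hm₁ : 0 < m₁) (hκ : ∀ t, κ t ∈ Icc (-1 : ℝ) (T + 1)) (s : ℝ) :
    (fun q => hProfile₁ f₁ φ₁ δ κ s q ^ 2 - f₁ q ^ 2) = fun q => -(2 * κ s * δ) * φ₁ q := by
  funext q
  rw [hProfile₁_sq hgap hm₁ hκ]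
  ring

/-- **`|∇p[w, h_{1,s}] - ∇p[w, f₁]| ≤ K(S₁ + S₂)` with `S₁ + S₂ = |2δκ(s)|(B₁ + B₂)`**, for
`w ∈ {v₁, 0}` (Appendix A.3, first lemma, on the pairs `(w,h_{1,s})`, `(w,f₁)`).
[cite: Ozanski2017NSISingular, App. A.3 (first lemma) and Lemma 4.1 (proof)] -/
theorem abs_pressureInteraction_hProfile₁_sub_le (h₁S : IsNSIStructure U₁ v₁ f₁ φ₁)
    (hgap : ∀ t ∈ Icc (-1 : ℝ) (T + 1), ∀ q ∈ tsupport φ₁,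
      (v₁ q).1 ^ 2 + (v₁ q).2 ^ 2 + m₁ ≤ f₁ q ^ 2 - 2 * t * δ * φ₁ q)
    (hm₁ : 0 < m₁) (hκ : ∀ t, κ t ∈ Icc (-1 : ℝ) (T + 1))
    (hstr : ∀ t, ∀ b : ℝ, |b| ≤ 1 → IsNSIStructure U₁ (b • v₁) (hProfile₁ f₁ φ₁ δ κ t) ψ₁)
    {K : ℝ} (hK : ∀ (v : ℝ × ℝ → ℝ × ℝ) (f g φ ψ : ℝ × ℝ → ℝ),
      IsNSIStructure U₁ v f φ → IsNSIStructure U₁ v g ψ → ∀ (S₁ S₂ : ℝ),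
      (∀ q, ‖fderiv ℝ (fun q' => f q' ^ 2 - g q' ^ 2) q‖ ≤ S₁) →
      (∀ q, ‖fderiv ℝ (fderiv ℝ fun q' => f q' ^ 2 - g q' ^ 2) q‖ ≤ S₂) → ∀ q : ℝ × ℝ,
        |derivR (planePressure v f) q - derivR (planePressure v g) q| ≤ K * (S₁ + S₂) ∧
        |derivZ (planePressure v f) q - derivZ (planePressure v g) q| ≤ K * (S₁ + S₂))
    {B₁ B₂ : ℝ} (hB₁ : ∀ q, ‖fderiv ℝ φ₁ q‖ ≤ B₁) (hB₂ : ∀ q, ‖fderiv ℝ (fderiv ℝ φ₁) q‖ ≤ B₂)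
    (s : ℝ) (q : ℝ × ℝ) :
    |(pressureInteraction v₁ (hProfile₁ f₁ φ₁ δ κ s) q).1 - (pressureInteraction v₁ f₁ q).1| ≤
        2 * (K * (|2 * κ s * δ| * (B₁ + B₂))) ∧
      |(pressureInteraction v₁ (hProfile₁ f₁ φ₁ δ κ s) q).2 - (pressureInteraction v₁ f₁ q).2| ≤
        2 * (K * (|2 * κ s * δ| * (B₁ + B₂))) := by
  set c : ℝ := 2 * κ s * δ with hc
  have hfun := fderiv_hProfile₁_sq_sub hgap hm₁ hκ s
  have hφd : Differentiable ℝ φ₁ := h₁S.φ_smooth.differentiable (by simp)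
  have hDφd : Differentiable ℝ (fderiv ℝ φ₁) :=
    (h₁S.φ_smooth.fderiv_right (m := ∞) (by simp)).differentiable (by simp)
  -- the bounds `S₁`, `S₂`
  have hD1 : fderiv ℝ (fun q => hProfile₁ f₁ φ₁ δ κ s q ^ 2 - f₁ q ^ 2) =
      fun q => (-c) • fderiv ℝ φ₁ q := by
    rw [hfun]; funext q
    exact fderiv_const_mul (hφd q) (-c)
  have hS₁ : ∀ q, ‖fderiv ℝ (fun q' => hProfile₁ f₁ φ₁ δ κ s q' ^ 2 - f₁ q' ^ 2) q‖ ≤ |c| * B₁ := by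
    intro q
    rw [hD1]
    show ‖(-c) • fderiv ℝ φ₁ q‖ ≤ |c| * B₁
    rw [norm_smul, Real.norm_eq_abs, abs_neg]
    exact mul_le_mul_of_nonneg_left (hB₁ q) (abs_nonneg c)
  have hS₂ : ∀ q, ‖fderiv ℝ (fderiv ℝ fun q' => hProfile₁ f₁ φ₁ δ κ s q' ^ 2 - f₁ q' ^ 2) q‖ ≤
      |c| * B₂ := by
    intro q
    rw [hD1]
    have : fderiv ℝ (fun q => (-c) • fderiv ℝ φ₁ q) q = (-c) • fderiv ℝ (fderiv ℝ φ₁) q :=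
      fderiv_const_smul (hDφd q) (-c)
    rw [this, norm_smul, Real.norm_eq_abs, abs_neg]
    exact mul_le_mul_of_nonneg_left (hB₂ q) (abs_nonneg c)
  -- the four structures
  have hh1 : IsNSIStructure U₁ v₁ (hProfile₁ f₁ φ₁ δ κ s) ψ₁ := by
    simpa using hstr s 1 (by norm_num)
  have hh0 : IsNSIStructure U₁ 0 (hProfile₁ f₁ φ₁ δ κ s) ψ₁ := by
    simpa using hstr s 0 (by norm_num)
  have k1 := hK v₁ _ _ _ _ hh1 h₁S _ _ hS₁ hS₂ q
  have k0 := hK 0 _ _ _ _ hh0 h₁S.zero_field _ _ hS₁ hS₂ q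
  have e : |c| * B₁ + |c| * B₂ = |c| * (B₁ + B₂) := by ring
  rw [e] at k1 k0
  simp only [pressureInteraction]
  constructor
  · calc |derivR (planePressure 0 (hProfile₁ f₁ φ₁ δ κ s)) q -
            derivR (planePressure v₁ (hProfile₁ f₁ φ₁ δ κ s)) q -
          (derivR (planePressure 0 f₁) q - derivR (planePressure v₁ f₁) q)|
        = |(derivR (planePressure 0 (hProfile₁ f₁ φ₁ δ κ s)) q - derivR (planePressure 0 f₁) q) -
            (derivR (planePressure v₁ (hProfile₁ f₁ φ₁ δ κ s)) q -
              derivR (planePressure v₁ f₁) q)| := by ring_nf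
      _ ≤ |derivR (planePressure 0 (hProfile₁ f₁ φ₁ δ κ s)) q - derivR (planePressure 0 f₁) q| +
            |derivR (planePressure v₁ (hProfile₁ f₁ φ₁ δ κ s)) q -
              derivR (planePressure v₁ f₁) q| := abs_sub _ _
      _ ≤ K * (|c| * (B₁ + B₂)) + K * (|c| * (B₁ + B₂)) := add_le_add k0.1 k1.1
      _ = 2 * (K * (|c| * (B₁ + B₂))) := by ring
  · calc |derivZ (planePressure 0 (hProfile₁ f₁ φ₁ δ κ s)) q -
            derivZ (planePressure v₁ (hProfile₁ f₁ φ₁ δ κ s)) q -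
          (derivZ (planePressure 0 f₁) q - derivZ (planePressure v₁ f₁) q)|
        = |(derivZ (planePressure 0 (hProfile₁ f₁ φ₁ δ κ s)) q - derivZ (planePressure 0 f₁) q) -
            (derivZ (planePressure v₁ (hProfile₁ f₁ φ₁ δ κ s)) q -
              derivZ (planePressure v₁ f₁) q)| := by ring_nf
      _ ≤ |derivZ (planePressure 0 (hProfile₁ f₁ φ₁ δ κ s)) q - derivZ (planePressure 0 f₁) q| +
            |derivZ (planePressure v₁ (hProfile₁ f₁ φ₁ δ κ s)) q -
              derivZ (planePressure v₁ f₁) q| := abs_sub _ _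
      _ ≤ K * (|c| * (B₁ + B₂)) + K * (|c| * (B₁ + B₂)) := add_le_add k0.2 k1.2
      _ = 2 * (K * (|c| * (B₁ + B₂))) := by ring

/-- **`|h²_{2,t}(q) - (f₂² - 2κ(t)δφ₂ + κ(t) v₂·F[v₁,f₁])(q)| ≤ |κ(t)| V (2K)(2δ(T+1))(B₁+B₂)`**:
"`h₂` depends continuously on `δ`", quantitatively (the interaction rate differs from
`v₂·F[v₁,f₁]` by at most `|v₂| · 2K(S₁+S₂)` at all times).
[cite: Ozanski2017NSISingular, Lemma 4.1 (proof)] -/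
theorem abs_hRadicand₂_sub_le (h₁S : IsNSIStructure U₁ v₁ f₁ φ₁)
    (hgap : ∀ t ∈ Icc (-1 : ℝ) (T + 1), ∀ q ∈ tsupport φ₁,
      (v₁ q).1 ^ 2 + (v₁ q).2 ^ 2 + m₁ ≤ f₁ q ^ 2 - 2 * t * δ * φ₁ q)
    (hm₁ : 0 < m₁) (hκ : ∀ t, κ t ∈ Icc (-1 : ℝ) (T + 1))
    (hstr : ∀ t, ∀ b : ℝ, |b| ≤ 1 → IsNSIStructure U₁ (b • v₁) (hProfile₁ f₁ φ₁ δ κ t) ψ₁)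
    {K : ℝ} (hK0 : 0 ≤ K) (hK : ∀ (v : ℝ × ℝ → ℝ × ℝ) (f g φ ψ : ℝ × ℝ → ℝ),
      IsNSIStructure U₁ v f φ → IsNSIStructure U₁ v g ψ → ∀ (S₁ S₂ : ℝ),
      (∀ q, ‖fderiv ℝ (fun q' => f q' ^ 2 - g q' ^ 2) q‖ ≤ S₁) →
      (∀ q, ‖fderiv ℝ (fderiv ℝ fun q' => f q' ^ 2 - g q' ^ 2) q‖ ≤ S₂) → ∀ q : ℝ × ℝ,
        |derivR (planePressure v f) q - derivR (planePressure v g) q| ≤ K * (S₁ + S₂) ∧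
        |derivZ (planePressure v f) q - derivZ (planePressure v g) q| ≤ K * (S₁ + S₂))
    {B₁ B₂ : ℝ} (hB₁0 : 0 ≤ B₁) (hB₂0 : 0 ≤ B₂) (hB₁ : ∀ q, ‖fderiv ℝ φ₁ q‖ ≤ B₁)
    (hB₂ : ∀ q, ‖fderiv ℝ (fderiv ℝ φ₁) q‖ ≤ B₂)
    {V : ℝ} (hV : ∀ q, |(v₂ q).1| + |(v₂ q).2| ≤ V) (hδ : 0 ≤ δ) (hT : 0 < T)
    (hΓc : Continuous (uncurry (interactionRate v₁ v₂ f₁ φ₁ δ κ))) (t : ℝ) (q : ℝ × ℝ) :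
    |hRadicand₂ v₁ v₂ f₁ φ₁ f₂ φ₂ δ κ t q -
        (f₂ q ^ 2 - 2 * κ t * δ * φ₂ q + κ t * ((v₂ q).1 * (pressureInteraction v₁ f₁ q).1 +
          (v₂ q).2 * (pressureInteraction v₁ f₁ q).2))| ≤
      |κ t| * (V * (2 * (K * (2 * δ * (T + 1) * (B₁ + B₂))))) := by
  have hκT : ∀ t, |κ t| ≤ T + 1 := fun t =>
    abs_le.2 ⟨by linarith [(hκ t).1], (hκ t).2⟩
  set Γ₀ : ℝ := (v₂ q).1 * (pressureInteraction v₁ f₁ q).1 +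
    (v₂ q).2 * (pressureInteraction v₁ f₁ q).2 with hΓ₀
  set E : ℝ := 2 * (K * (2 * δ * (T + 1) * (B₁ + B₂))) with hE
  -- pointwise bound on the rate difference
  have hpt : ∀ s, |interactionRate v₁ v₂ f₁ φ₁ δ κ s q - Γ₀| ≤ V * E := by
    intro s
    have hb := abs_pressureInteraction_hProfile₁_sub_le h₁S hgap hm₁ hκ hstr hK hB₁ hB₂ s q
    have hcs : |2 * κ s * δ| ≤ 2 * δ * (T + 1) := by
      rw [abs_mul, abs_mul, abs_two, abs_of_nonneg hδ]
      nlinarith [hκT s, abs_nonneg (κ s)]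
    have hE' : 2 * (K * (|2 * κ s * δ| * (B₁ + B₂))) ≤ E := by
      have : |2 * κ s * δ| * (B₁ + B₂) ≤ 2 * δ * (T + 1) * (B₁ + B₂) :=
        mul_le_mul_of_nonneg_right hcs (by positivity)
      nlinarith
    set d₁ := (pressureInteraction v₁ (hProfile₁ f₁ φ₁ δ κ s) q).1 - (pressureInteraction v₁ f₁ q).1
    set d₂ := (pressureInteraction v₁ (hProfile₁ f₁ φ₁ δ κ s) q).2 - (pressureInteraction v₁ f₁ q).2
    have h1 : |d₁| ≤ E := hb.1.trans hE'
    have h2 : |d₂| ≤ E := hb.2.trans hE'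
    have hE0 : 0 ≤ E := (abs_nonneg _).trans h1
    have e : interactionRate v₁ v₂ f₁ φ₁ δ κ s q - Γ₀ = (v₂ q).1 * d₁ + (v₂ q).2 * d₂ := by
      simp only [interactionRate, hΓ₀, d₁, d₂]; ring
    rw [e]
    calc |(v₂ q).1 * d₁ + (v₂ q).2 * d₂| ≤ |(v₂ q).1 * d₁| + |(v₂ q).2 * d₂| := abs_add_le _ _
      _ = |(v₂ q).1| * |d₁| + |(v₂ q).2| * |d₂| := by rw [abs_mul, abs_mul]
      _ ≤ |(v₂ q).1| * E + |(v₂ q).2| * E :=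
          add_le_add (mul_le_mul_of_nonneg_left h1 (abs_nonneg _))
            (mul_le_mul_of_nonneg_left h2 (abs_nonneg _))
      _ = (|(v₂ q).1| + |(v₂ q).2|) * E := by ring
      _ ≤ V * E := mul_le_mul_of_nonneg_right (hV q) hE0
  -- integrate
  have hci : Continuous fun s => interactionRate v₁ v₂ f₁ φ₁ δ κ s q :=
    hΓc.comp (Continuous.prodMk_left q)
  have hint : IntervalIntegrable (fun s => interactionRate v₁ v₂ f₁ φ₁ δ κ s q) volume 0 (κ t) :=
    hci.intervalIntegrable _ _
  have hsplit : ∫ s in (0 : ℝ)..κ t, interactionRate v₁ v₂ f₁ φ₁ δ κ s q =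
      κ t * Γ₀ + ∫ s in (0 : ℝ)..κ t, (interactionRate v₁ v₂ f₁ φ₁ δ κ s q - Γ₀) := by
    rw [intervalIntegral.integral_sub hint intervalIntegrable_const, intervalIntegral.integral_const,
      smul_eq_mul, sub_zero]
    ring
  have hI : |∫ s in (0 : ℝ)..κ t, (interactionRate v₁ v₂ f₁ φ₁ δ κ s q - Γ₀)| ≤ V * E * |κ t| := by
    have := norm_primitive_param_le (Φ := fun s (_ : Unit) => interactionRate v₁ v₂ f₁ φ₁ δ κ s q - Γ₀)
      (x := ()) (t := κ t) (C := V * E) fun s _ => by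
        simpa [Real.norm_eq_abs] using hpt s
    simpa [Real.norm_eq_abs] using this
  have e2 : hRadicand₂ v₁ v₂ f₁ φ₁ f₂ φ₂ δ κ t q - (f₂ q ^ 2 - 2 * κ t * δ * φ₂ q + κ t * Γ₀) =
      ∫ s in (0 : ℝ)..κ t, (interactionRate v₁ v₂ f₁ φ₁ δ κ s q - Γ₀) := by
    rw [hRadicand₂, hsplit]; ring
  rw [e2]
  calc |∫ s in (0 : ℝ)..κ t, (interactionRate v₁ v₂ f₁ φ₁ δ κ s q - Γ₀)| ≤ V * E * |κ t| := hI
    _ = |κ t| * (V * E) := by ring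

end Estimates

/-! ### The compactness constants of the arrangement -/

section Constants

variable {U₁ U₂ : Set (ℝ × ℝ)} {v₁ : ℝ × ℝ → ℝ × ℝ} {f₁ φ₁ : ℝ × ℝ → ℝ} {v₂ : ℝ × ℝ → ℝ × ℝ}
  {f₂ φ₂ : ℝ × ℝ → ℝ} {T τ : ℝ} {z : ℝ³}

/-- **The interaction gap on `[0,T] × supp φ₂`**: `f₂² - |v₂|² + t v₂·F[v₁,f₁] ≥ μ > 0` there
(at `t = 0` by Definition 3.3, at `t = T` by (4.1), in between by linearity in `t`; a positive
minimum on a compact set): "both of the above functions are greater than `|v₂|²` in `U₂` … Since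
`h_{2,t}` in (4.12) depends linearly on `t` we thus obtain `h_{2,t} > |v₂|` in `supp φ₂` for
`t ∈ [0,T]` if `δ = 0`". [cite: Ozanski2017NSISingular, Lemma 4.1 (proof, (4.12))] -/
theorem IsNSIArrangement.exists_interaction_gap
    (hA : IsNSIArrangement U₁ U₂ v₁ f₁ φ₁ v₂ f₂ φ₂ T τ z) :
    ∃ μ > 0, ∀ t ∈ Icc (0 : ℝ) T, ∀ q ∈ tsupport φ₂,
      μ ≤ f₂ q ^ 2 - ((v₂ q).1 ^ 2 + (v₂ q).2 ^ 2) +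
        t * ((v₂ q).1 * (pressureInteraction v₁ f₁ q).1 + (v₂ q).2 * (pressureInteraction v₁ f₁ q).2) := by
  have h₂ := hA.structure₂
  set A : ℝ × (ℝ × ℝ) → ℝ := fun p => f₂ p.2 ^ 2 - ((v₂ p.2).1 ^ 2 + (v₂ p.2).2 ^ 2) +
    p.1 * ((v₂ p.2).1 * (pressureInteraction v₁ f₁ p.2).1 +
      (v₂ p.2).2 * (pressureInteraction v₁ f₁ p.2).2) with hAdef
  have hFc := hA.structure₁.continuous_pressureInteraction
  have hv := h₂.v_smooth.continuous
  have hAc : Continuous A := by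
    have hv' := hv.comp continuous_snd (f := fun p : ℝ × (ℝ × ℝ) => p.2)
    have hF' := hFc.comp continuous_snd (f := fun p : ℝ × (ℝ × ℝ) => p.2)
    exact (((h₂.f_smooth.continuous.comp continuous_snd).pow 2).sub
      (((continuous_fst.comp hv').pow 2).add ((continuous_snd.comp hv').pow 2))).add
      (continuous_fst.mul (((continuous_fst.comp hv').mul (continuous_fst.comp hF')).add
        ((continuous_snd.comp hv').mul (continuous_snd.comp hF'))))
  have hpos : ∀ p ∈ Icc (0 : ℝ) T ×ˢ tsupport φ₂, 0 < A p := by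
    rintro ⟨t, q⟩ ⟨ht, hq⟩
    have hqU : q ∈ U₂ := h₂.tsupport_φ hq
    have h0 : 0 < f₂ q ^ 2 - ((v₂ q).1 ^ 2 + (v₂ q).2 ^ 2) := sub_pos.2 (h₂.sq_lt q hqU)
    have hT : 0 < f₂ q ^ 2 - ((v₂ q).1 ^ 2 + (v₂ q).2 ^ 2) +
        T * ((v₂ q).1 * (pressureInteraction v₁ f₁ q).1 +
          (v₂ q).2 * (pressureInteraction v₁ f₁ q).2) := by
      have := hA.sq_lt q hqU; linarith
    have hTpos := hA.T_pos
    -- convex combination in `t`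
    have key : A (t, q) = (1 - t / T) * (f₂ q ^ 2 - ((v₂ q).1 ^ 2 + (v₂ q).2 ^ 2)) +
        (t / T) * (f₂ q ^ 2 - ((v₂ q).1 ^ 2 + (v₂ q).2 ^ 2) +
          T * ((v₂ q).1 * (pressureInteraction v₁ f₁ q).1 +
            (v₂ q).2 * (pressureInteraction v₁ f₁ q).2)) := by
      simp only [hAdef]; field_simp; ring
    rw [key]
    have h1 : 0 ≤ t / T := div_nonneg ht.1 hTpos.le
    have h2 : 0 ≤ 1 - t / T := by rw [sub_nonneg, div_le_one hTpos]; exact ht.2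
    rcases h1.lt_or_eq with h1' | h1'
    · nlinarith
    · rw [← h1']; nlinarith
  have hKc : IsCompact (Icc (0 : ℝ) T ×ˢ tsupport φ₂) := isCompact_Icc.prod h₂.isCompact_tsupport_φ
  rcases (Icc (0 : ℝ) T ×ˢ tsupport φ₂).eq_empty_or_nonempty with hE | hE
  · refine ⟨1, one_pos, fun t ht q hq => ?_⟩
    have : ((t, q) : ℝ × (ℝ × ℝ)) ∈ Icc (0 : ℝ) T ×ˢ tsupport φ₂ := ⟨ht, hq⟩
    simp [hE] at this
  · obtain ⟨p₀, hp₀, hmin⟩ := hKc.exists_isMinOn hE hAc.continuousOn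
    exact ⟨A p₀, hpos p₀ hp₀, fun t ht q hq => hmin (show ((t, q) : ℝ × (ℝ × ℝ)) ∈ _ from ⟨ht, hq⟩)⟩

/-- **The gain margin `θ`** ((4.8)): `f₂(y)² + T v₂(y)·F[v₁,f₁](y) ≥ τ⁻²(f₁(R⁻¹x) + f₂(R⁻¹x))² + θ`
for `x ∈ G`, `y = R⁻¹(Γx)`, `θ > 0` ("such a choice is possible by continuity since the inequality
in (4.2) is strict and `G` is compact"). [cite: Ozanski2017NSISingular, §4 (4.8)] -/
theorem IsNSIArrangement.exists_gain_margin
    (hA : IsNSIArrangement U₁ U₂ v₁ f₁ φ₁ v₂ f₂ φ₂ T τ z) :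
    ∃ θ > 0, ∀ x ∈ revolve (closure U₁ ∪ closure U₂),
      τ⁻¹ ^ 2 * (f₁ (meridian x) + f₂ (meridian x)) ^ 2 + θ ≤
        f₂ (meridian (τ • x + z)) ^ 2 +
          T * ((v₂ (meridian (τ • x + z))).1 * (pressureInteraction v₁ f₁ (meridian (τ • x + z))).1 +
            (v₂ (meridian (τ • x + z))).2 * (pressureInteraction v₁ f₁ (meridian (τ • x + z))).2) := by
  set Gn : ℝ³ → ℝ := fun x => f₂ (meridian (τ • x + z)) ^ 2 +
      T * ((v₂ (meridian (τ • x + z))).1 * (pressureInteraction v₁ f₁ (meridian (τ • x + z))).1 +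
        (v₂ (meridian (τ • x + z))).2 * (pressureInteraction v₁ f₁ (meridian (τ • x + z))).2) -
      τ⁻¹ ^ 2 * (f₁ (meridian x) + f₂ (meridian x)) ^ 2 with hGn
  have hm : Continuous fun x : ℝ³ => meridian (τ • x + z) :=
    continuous_meridian.comp (by fun_prop)
  have hFc := hA.structure₁.continuous_pressureInteraction
  have hv := hA.structure₂.v_smooth.continuous
  have hGc : Continuous Gn := by
    have hv' := hv.comp hm
    have hF' := hFc.comp hm
    exact (((hA.structure₂.f_smooth.continuous.comp hm).pow 2).add
      (continuous_const.mul (((continuous_fst.comp hv').mul (continuous_fst.comp hF')).add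
        ((continuous_snd.comp hv').mul (continuous_snd.comp hF'))))).sub
      (continuous_const.mul (((hA.structure₁.f_smooth.continuous.comp continuous_meridian).add
        (hA.structure₂.f_smooth.continuous.comp continuous_meridian)).pow 2))
  have hpos : ∀ x ∈ revolve (closure U₁ ∪ closure U₂), 0 < Gn x := fun x hx => by
    have := hA.gain x hx; simp only [hGn]; linarith
  obtain ⟨x₀, hx₀, hmin⟩ := hA.isCompact_revolve.exists_isMinOn hA.nonempty_revolve hGc.continuousOn
  refine ⟨Gn x₀, hpos x₀ hx₀, fun x hx => ?_⟩
  have := hmin hx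
  simp only [hGn, mem_setOf_eq] at this
  simp only [hGn]
  linarith

/-- A bound `|v₂,₁| + |v₂,₂| ≤ V` for the compactly supported planar field of a structure. [folklore] -/
theorem IsNSIStructure.exists_abs_v_le {U : Set (ℝ × ℝ)} {v : ℝ × ℝ → ℝ × ℝ} {f φ : ℝ × ℝ → ℝ}
    (h : IsNSIStructure U v f φ) : ∃ V : ℝ, 0 ≤ V ∧ ∀ q, |(v q).1| + |(v q).2| ≤ V := by
  have hc : HasCompactSupport v :=
    h.isCompact_closure.of_isClosed_subset (isClosed_tsupport v)
      (h.tsupport_v_subset.trans subset_closure)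
  obtain ⟨C, hC⟩ := hc.exists_bound_of_continuous h.v_smooth.continuous
  have hC0 : 0 ≤ C := (norm_nonneg _).trans (hC 0)
  refine ⟨C + C, by positivity, fun q => ?_⟩
  have h1 := hC q
  rw [Prod.norm_def, max_le_iff] at h1
  simp only [Real.norm_eq_abs] at h1
  linarith [h1.1, h1.2]

/-- A bound `|v₂·F[v₁,f₁]| ≤ M` for the (compactly supported, continuous) printed interaction
rate. [folklore] -/
theorem IsNSIArrangement.exists_abs_interaction_le
    (hA : IsNSIArrangement U₁ U₂ v₁ f₁ φ₁ v₂ f₂ φ₂ T τ z) :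
    ∃ M : ℝ, 0 ≤ M ∧ ∀ q, |(v₂ q).1 * (pressureInteraction v₁ f₁ q).1 +
      (v₂ q).2 * (pressureInteraction v₁ f₁ q).2| ≤ M := by
  set Γ₀ : ℝ × ℝ → ℝ := fun q => (v₂ q).1 * (pressureInteraction v₁ f₁ q).1 +
    (v₂ q).2 * (pressureInteraction v₁ f₁ q).2 with hΓ₀
  have hFc := hA.structure₁.continuous_pressureInteraction
  have hv := hA.structure₂.v_smooth.continuous
  have hc : Continuous Γ₀ :=
    ((continuous_fst.comp hv).mul (continuous_fst.comp hFc)).add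
      ((continuous_snd.comp hv).mul (continuous_snd.comp hFc))
  have hsupp : HasCompactSupport Γ₀ := by
    refine HasCompactSupport.intro (hA.structure₂.isCompact_closure) fun q hq => ?_
    simp [hΓ₀, hA.structure₂.v_eq_zero hq]
  obtain ⟨M, hM⟩ := hsupp.exists_bound_of_continuous hc
  exact ⟨max M 0, le_max_right _ _, fun q =>
    ((Real.norm_eq_abs _).symm.le.trans (hM q)).trans (le_max_left _ _)⟩

end Constants

/-! ### Lemma 4.1 -/

/-- **The data of Lemma 4.1, packaged** (what §4.1–4.2 use of `δ, h_{1,t}, h_{2,t}`): a slack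
`δ > 0`; a smooth time clamp `κ` (`κ = id` and `κ' = 1` on `[0,T]`, `-1/2 ≤ κ ≤ T+1/2`); the gaps
`fᵢ² - 2tδφᵢ ≥ |vᵢ|² + mᵢ` on `supp φᵢ` and the structure criteria for both structures on the
whole time range `[-1, T+1]` met (through the clamp) by `h_{i,t}` ((4.10), (4.13)) and later by
`qᵏ_{i,t}` ((4.20)); smoothness of the first damped profile on `(-1,T+1) × ℝ²`; the core
inequality **`h_{2,t} > |v₂|` on `{φ₂ = 1}` for all `t`** ((4.10), `i = 2`); and **the gain
(4.11)**: `h²_{2,T}(R⁻¹(Γx)) ≥ τ⁻²(f₁(R⁻¹x) + f₂(R⁻¹x))² + θ` on `G`, `θ > 0`.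
[cite: Ozanski2017NSISingular, Lemma 4.1 ((4.9)–(4.11)) and (4.13)] -/
structure IsHProfileData (U₁ U₂ : Set (ℝ × ℝ)) (v₁ v₂ : ℝ × ℝ → ℝ × ℝ) (f₁ φ₁ f₂ φ₂ : ℝ × ℝ → ℝ)
    (T τ : ℝ) (z : ℝ³) (δ : ℝ) (κ : ℝ → ℝ) (ψ₁ ψ₂ : ℝ × ℝ → ℝ) (m₁ m₂ θ : ℝ) : Prop where
  /-- `δ > 0`. -/
  δ_pos : 0 < δ
  /-- `T > 0`. -/
  T_pos : 0 < T
  /-- The clamp is smooth, -/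
  κ_smooth : ContDiff ℝ ∞ κ
  /-- is the identity on `[0,T]`, -/
  κ_eq : ∀ t ∈ Icc (0 : ℝ) T, κ t = t
  /-- has derivative `1` on `[0,T]`, -/
  deriv_κ_eq : ∀ t ∈ Icc (0 : ℝ) T, deriv κ t = 1
  /-- derivative in `[0,1]` everywhere, -/
  deriv_κ_mem : ∀ t, deriv κ t ∈ Icc (0 : ℝ) 1
  /-- and range in `[-1/2, T+1/2]`. -/
  κ_mem : ∀ t, κ t ∈ Icc (-(1 / 2) : ℝ) (T + 1 / 2)
  /-- `m₁ > 0`, -/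
  m₁_pos : 0 < m₁
  /-- `m₂ > 0`. -/
  m₂_pos : 0 < m₂
  /-- The gap of the first structure on the time range `[-1, T+1]`: -/
  gap₁ : ∀ t ∈ Icc (-1 : ℝ) (T + 1), ∀ q ∈ tsupport φ₁,
    (v₁ q).1 ^ 2 + (v₁ q).2 ^ 2 + m₁ ≤ f₁ q ^ 2 - 2 * t * δ * φ₁ q
  /-- the gap of the second structure: -/
  gap₂ : ∀ t ∈ Icc (-1 : ℝ) (T + 1), ∀ q ∈ tsupport φ₂,
    (v₂ q).1 ^ 2 + (v₂ q).2 ^ 2 + m₂ ≤ f₂ q ^ 2 - 2 * t * δ * φ₂ q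
  /-- the first damped profile is jointly smooth on `(-1,T+1) × ℝ²`: -/
  smooth₁ : ContDiffOn ℝ ∞ (uncurry (dampedProfile f₁ φ₁ δ)) (Ioo (-1 : ℝ) (T + 1) ×ˢ univ)
  /-- the perturbation criterion for the first structure: -/
  crit₁ : DampedCriterion U₁ v₁ f₁ φ₁ ψ₁ δ T
  /-- the perturbation criterion for the second structure. -/
  crit₂ : DampedCriterion U₂ v₂ f₂ φ₂ ψ₂ δ T
  /-- **(4.10), `i = 2`, the core: `h_{2,t} > |v₂|` on `{φ₂ = 1}` for all `t`.** -/
  core₂ : ∀ t q, φ₂ q = 1 →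
    (v₂ q).1 ^ 2 + (v₂ q).2 ^ 2 < hProfile₂ v₁ v₂ f₁ φ₁ f₂ φ₂ δ κ t q ^ 2
  /-- `θ > 0`. -/
  θ_pos : 0 < θ
  /-- **(4.11), the gain at `t = T`.** -/
  gain : ∀ x ∈ revolve (closure U₁ ∪ closure U₂),
    τ⁻¹ ^ 2 * (f₁ (meridian x) + f₂ (meridian x)) ^ 2 + θ ≤
      hProfile₂ v₁ v₂ f₁ φ₁ f₂ φ₂ δ κ T (meridian (τ • x + z)) ^ 2

namespace IsHProfileData

variable {U₁ U₂ : Set (ℝ × ℝ)} {v₁ v₂ : ℝ × ℝ → ℝ × ℝ} {f₁ φ₁ f₂ φ₂ : ℝ × ℝ → ℝ} {T τ : ℝ}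
  {z : ℝ³} {δ : ℝ} {κ : ℝ → ℝ} {ψ₁ ψ₂ : ℝ × ℝ → ℝ} {m₁ m₂ θ : ℝ}

/-- The clamped times lie in `[-1, T+1]`. [folklore] -/
theorem κ_mem_Icc (hH : IsHProfileData U₁ U₂ v₁ v₂ f₁ φ₁ f₂ φ₂ T τ z δ κ ψ₁ ψ₂ m₁ m₂ θ) (t : ℝ) :
    κ t ∈ Icc (-1 : ℝ) (T + 1) :=
  ⟨by linarith [(hH.κ_mem t).1], by linarith [(hH.κ_mem t).2]⟩

/-- The clamped times lie in `(-1, T+1)`. [folklore] -/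
theorem κ_mem_Ioo (hH : IsHProfileData U₁ U₂ v₁ v₂ f₁ φ₁ f₂ φ₂ T τ z δ κ ψ₁ ψ₂ m₁ m₂ θ) (t : ℝ) :
    κ t ∈ Ioo (-1 : ℝ) (T + 1) :=
  ⟨by linarith [(hH.κ_mem t).1], by linarith [(hH.κ_mem t).2]⟩

/-- `|κ| ≤ T + 1`. [folklore] -/
theorem abs_κ_le (hH : IsHProfileData U₁ U₂ v₁ v₂ f₁ φ₁ f₂ φ₂ T τ z δ κ ψ₁ ψ₂ m₁ m₂ θ) (t : ℝ) :
    |κ t| ≤ T + 1 :=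
  abs_le.2 ⟨by linarith [(hH.κ_mem_Icc t).1, hH.T_pos], (hH.κ_mem_Icc t).2⟩

/-- **(4.9): `h²_{1,t} = f₁² - 2κ(t)δφ₁`.** [cite: Ozanski2017NSISingular, Lemma 4.1 (4.9)] -/
theorem hProfile₁_sq (hH : IsHProfileData U₁ U₂ v₁ v₂ f₁ φ₁ f₂ φ₂ T τ z δ κ ψ₁ ψ₂ m₁ m₂ θ)
    (t : ℝ) (q : ℝ × ℝ) :
    hProfile₁ f₁ φ₁ δ κ t q ^ 2 = f₁ q ^ 2 - 2 * κ t * δ * φ₁ q :=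
  Literature.Barriers.NavierStokesRegularity.hProfile₁_sq hH.gap₁ hH.m₁_pos hH.κ_mem_Icc t q

/-- **`h₁` is jointly smooth.** [cite: Ozanski2017NSISingular, Lemma 4.1] -/
theorem contDiff_hProfile₁ (hH : IsHProfileData U₁ U₂ v₁ v₂ f₁ φ₁ f₂ φ₂ T τ z δ κ ψ₁ ψ₂ m₁ m₂ θ) :
    ContDiff ℝ ∞ (uncurry (hProfile₁ f₁ φ₁ δ κ)) :=
  Literature.Barriers.NavierStokesRegularity.contDiff_hProfile₁ hH.smooth₁ hH.κ_smooth hH.κ_mem_Ioo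

/-- **`(bv₁, h_{1,t}, ψ₁)` is a structure on `U₁`** for all `t`, `|b| ≤ 1` ((4.10), (4.13)).
[cite: Ozanski2017NSISingular, Lemma 4.1 (4.10) and (4.13)] -/
theorem isNSIStructure₁ (hH : IsHProfileData U₁ U₂ v₁ v₂ f₁ φ₁ f₂ φ₂ T τ z δ κ ψ₁ ψ₂ m₁ m₂ θ)
    (t : ℝ) {b : ℝ} (hb : |b| ≤ 1) :
    IsNSIStructure U₁ (b • v₁) (hProfile₁ f₁ φ₁ δ κ t) ψ₁ :=
  isNSIStructure_hProfile₁ hH.crit₁ hH.gap₁ hH.m₁_pos hH.contDiff_hProfile₁ hH.κ_mem_Icc t hb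

/-- `(v₁, h_{1,t}, ψ₁)` is a structure on `U₁` for all `t` ((4.10)). [cite: Ozanski2017NSISingular, Lemma 4.1 (4.10)] -/
theorem isNSIStructure₁_one (hH : IsHProfileData U₁ U₂ v₁ v₂ f₁ φ₁ f₂ φ₂ T τ z δ κ ψ₁ ψ₂ m₁ m₂ θ)
    (t : ℝ) : IsNSIStructure U₁ v₁ (hProfile₁ f₁ φ₁ δ κ t) ψ₁ := by
  simpa using hH.isNSIStructure₁ t (b := 1) (by norm_num)

/-- `h_{1,t} = f₁` off `supp φ₁`. [cite: Ozanski2017NSISingular, Lemma 4.1 ("`h_{i,t} = fᵢ` outside `supp φᵢ`")] -/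
theorem hProfile₁_eq_of_notMem {t : ℝ} {q : ℝ × ℝ} (h₁S : IsNSIStructure U₁ v₁ f₁ φ₁)
    (hq : q ∉ tsupport φ₁) : hProfile₁ f₁ φ₁ δ κ t q = f₁ q :=
  h₁S.dampedProfile_eq_of_notMem δ _ hq

/-- **The interaction rate is jointly smooth.** [cite: Ozanski2017NSISingular, Lemma 4.1 (4.9)] -/
theorem contDiff_interactionRate
    (hH : IsHProfileData U₁ U₂ v₁ v₂ f₁ φ₁ f₂ φ₂ T τ z δ κ ψ₁ ψ₂ m₁ m₂ θ)
    (h₁S : IsNSIStructure U₁ v₁ f₁ φ₁) (h₂S : IsNSIStructure U₂ v₂ f₂ φ₂) :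
    ContDiff ℝ ∞ (uncurry (interactionRate v₁ v₂ f₁ φ₁ δ κ)) :=
  Literature.Barriers.NavierStokesRegularity.contDiff_interactionRate h₁S h₂S.v_smooth
    hH.contDiff_hProfile₁ hH.isNSIStructure₁_one

/-- **The radicand `h²_{2,t}` is jointly smooth.** [cite: Ozanski2017NSISingular, Lemma 4.1] -/
theorem contDiff_hRadicand₂
    (hH : IsHProfileData U₁ U₂ v₁ v₂ f₁ φ₁ f₂ φ₂ T τ z δ κ ψ₁ ψ₂ m₁ m₂ θ)
    (h₁S : IsNSIStructure U₁ v₁ f₁ φ₁) (h₂S : IsNSIStructure U₂ v₂ f₂ φ₂) :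
    ContDiff ℝ ∞ (uncurry (hRadicand₂ v₁ v₂ f₁ φ₁ f₂ φ₂ δ κ)) :=
  Literature.Barriers.NavierStokesRegularity.contDiff_hRadicand₂ h₂S.f_smooth h₂S.φ_smooth
    hH.κ_smooth (hH.contDiff_interactionRate h₁S h₂S)

/-- **`h²_{2,t} > |v₂|² ≥ 0` on `U₂` for all `t`** (on `{φ₂ = 1}` the core, on `{φ₂ < 1}` the gap).
[cite: Ozanski2017NSISingular, Lemma 4.1 (4.10)] -/
theorem hRadicand₂_pos (hH : IsHProfileData U₁ U₂ v₁ v₂ f₁ φ₁ f₂ φ₂ T τ z δ κ ψ₁ ψ₂ m₁ m₂ θ)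
    (h₂S : IsNSIStructure U₂ v₂ f₂ φ₂) (t : ℝ) {q : ℝ × ℝ} (hq : q ∈ U₂) :
    0 < hRadicand₂ v₁ v₂ f₁ φ₁ f₂ φ₂ δ κ t q := by
  rcases (h₂S.φ_mem q).2.lt_or_eq with hφ | hφ
  · rw [hRadicand₂_of_v₂_eq_zero (h₂S.v_eq_zero_of_lt hφ)]
    exact h₂S.radicand_pos_of_gap hH.m₂_pos (hH.gap₂ (κ t) (hH.κ_mem_Icc t)) hq
  · have hc := hH.core₂ t q hφ
    have hnn : 0 ≤ (v₂ q).1 ^ 2 + (v₂ q).2 ^ 2 := by positivity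
    have hlt : 0 < hProfile₂ v₁ v₂ f₁ φ₁ f₂ φ₂ δ κ t q ^ 2 := hnn.trans_lt hc
    by_contra hle
    have hle' : hRadicand₂ v₁ v₂ f₁ φ₁ f₂ φ₂ δ κ t q ≤ 0 := not_lt.1 hle
    have : hProfile₂ v₁ v₂ f₁ φ₁ f₂ φ₂ δ κ t q = 0 := by
      rw [hProfile₂]; exact Real.sqrt_eq_zero'.2 hle'
    rw [this] at hlt
    simp at hlt

/-- **`h₂` is jointly smooth.** [cite: Ozanski2017NSISingular, Lemma 4.1] -/
theorem contDiff_hProfile₂ (hH : IsHProfileData U₁ U₂ v₁ v₂ f₁ φ₁ f₂ φ₂ T τ z δ κ ψ₁ ψ₂ m₁ m₂ θ)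
    (h₁S : IsNSIStructure U₁ v₁ f₁ φ₁) (h₂S : IsNSIStructure U₂ v₂ f₂ φ₂) :
    ContDiff ℝ ∞ (uncurry (hProfile₂ v₁ v₂ f₁ φ₁ f₂ φ₂ δ κ)) :=
  Literature.Barriers.NavierStokesRegularity.contDiff_hProfile₂ h₂S (hH.contDiff_hRadicand₂ h₁S h₂S)
    fun t _ hq => hH.hRadicand₂_pos h₂S t hq

/-- **(4.9): `h²_{2,t} = f₂² - 2κ(t)δφ₂ + ∫₀^{κ(t)} v₂·F[v₁,h_{1,s}] ds` everywhere** (the radicand is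
nonnegative: positive on `U₂`, equal to `f₂² ≥ 0` off it). [cite: Ozanski2017NSISingular, Lemma 4.1 (4.9)] -/
theorem hProfile₂_sq (hH : IsHProfileData U₁ U₂ v₁ v₂ f₁ φ₁ f₂ φ₂ T τ z δ κ ψ₁ ψ₂ m₁ m₂ θ)
    (h₂S : IsNSIStructure U₂ v₂ f₂ φ₂) (t : ℝ) (q : ℝ × ℝ) :
    hProfile₂ v₁ v₂ f₁ φ₁ f₂ φ₂ δ κ t q ^ 2 = hRadicand₂ v₁ v₂ f₁ φ₁ f₂ φ₂ δ κ t q := by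
  rw [hProfile₂, Real.sq_sqrt]
  by_cases hq : q ∈ U₂
  · exact (hH.hRadicand₂_pos h₂S t hq).le
  · have hφ : φ₂ q = 0 := image_eq_zero_of_notMem_tsupport fun h' => hq (h₂S.tsupport_φ h')
    rw [hRadicand₂_of_v₂_eq_zero (h₂S.v_eq_zero_of_lt (by rw [hφ]; norm_num)), hφ, mul_zero,
      sub_zero]
    exact sq_nonneg _

/-- **`(bv₂, h_{2,t}, ψ₂)` is a structure on `U₂`** for all `t`, `|b| ≤ 1` ((4.10), (4.13)).
[cite: Ozanski2017NSISingular, Lemma 4.1 (4.10) and (4.13)] -/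
theorem isNSIStructure₂ (hH : IsHProfileData U₁ U₂ v₁ v₂ f₁ φ₁ f₂ φ₂ T τ z δ κ ψ₁ ψ₂ m₁ m₂ θ)
    (h₁S : IsNSIStructure U₁ v₁ f₁ φ₁) (h₂S : IsNSIStructure U₂ v₂ f₂ φ₂) (t : ℝ) {b : ℝ}
    (hb : |b| ≤ 1) : IsNSIStructure U₂ (b • v₂) (hProfile₂ v₁ v₂ f₁ φ₁ f₂ φ₂ δ κ t) ψ₂ :=
  isNSIStructure_hProfile₂ h₂S hH.crit₂ hH.κ_mem_Icc (hH.contDiff_hProfile₂ h₁S h₂S) hH.core₂ t hb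

/-- `h_{2,t} = f₂` off `supp φ₂`. [cite: Ozanski2017NSISingular, Lemma 4.1 ("`h_{i,t} = fᵢ` outside `supp φᵢ`")] -/
theorem hProfile₂_eq_of_notMem (t : ℝ) {q : ℝ × ℝ} (h₂S : IsNSIStructure U₂ v₂ f₂ φ₂)
    (hq : q ∉ tsupport φ₂) : hProfile₂ v₁ v₂ f₁ φ₁ f₂ φ₂ δ κ t q = f₂ q := by
  have hφ : φ₂ q = 0 := image_eq_zero_of_notMem_tsupport hq
  rw [hProfile₂_eq_dampedProfile h₂S t (by rw [hφ]; norm_num), h₂S.dampedProfile_eq_of_notMem δ _ hq]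

end IsHProfileData

/-! ### Lemma 4.1: the choice of the constants -/

/-- The clamp overshoot: `0 < ε ≤ 1/2` with `εM ≤ μ/2`. [folklore] -/
theorem exists_overshoot {μ M : ℝ} (hμ : 0 < μ) (hM : 0 ≤ M) :
    ∃ ε : ℝ, 0 < ε ∧ ε ≤ 1 / 2 ∧ ε * M ≤ μ / 2 := by
  refine ⟨min (1 / 2) (μ / (2 * (M + 1))), lt_min (by norm_num) (by positivity), min_le_left _ _, ?_⟩
  have h1 : min (1 / 2) (μ / (2 * (M + 1))) * M ≤ μ / (2 * (M + 1)) * M :=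
    mul_le_mul_of_nonneg_right (min_le_right _ _) hM
  have h2 : μ / (2 * (M + 1)) * M ≤ μ / 2 := by
    rw [div_mul_eq_mul_div, div_le_div_iff₀ (by positivity) (by positivity)]
    nlinarith
  exact h1.trans h2

/-- The slack `δ > 0` below five explicit caps and two rate constraints. [folklore] -/
theorem exists_slack {T d₁ d₂ d₃ d₄ d₅ μ θ₀ C₀ : ℝ} (hT : 0 < T) (hd₁ : 0 < d₁) (hd₂ : 0 < d₂)
    (hd₃ : 0 < d₃) (hd₄ : 0 < d₄) (hd₅ : 0 < d₅) (hμ : 0 < μ) (hθ₀ : 0 < θ₀) (hC₀ : 0 ≤ C₀) :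
    ∃ δ : ℝ, 0 < δ ∧ δ ≤ d₁ ∧ δ ≤ d₂ ∧ δ ≤ d₃ ∧ δ ≤ d₄ ∧ δ ≤ d₅ ∧
      δ * (2 * (T + 1) + C₀) ≤ μ / 4 ∧ δ * (2 * T + C₀) ≤ θ₀ / 2 := by
  -- numerator the least of the targets, one common denominator `D ≥ 1` dominating the rates
  set n : ℝ := min (min (min d₁ d₂) (min d₃ d₄)) (min d₅ (min (μ / 4) (θ₀ / 2))) with hn
  have hnpos : 0 < n := by
    simp only [hn, lt_min_iff]
    exact ⟨⟨⟨hd₁, hd₂⟩, ⟨hd₃, hd₄⟩⟩, hd₅, by positivity, by positivity⟩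
  have hn₁ : n ≤ d₁ := (min_le_left _ _).trans ((min_le_left _ _).trans (min_le_left _ _))
  have hn₂ : n ≤ d₂ := (min_le_left _ _).trans ((min_le_left _ _).trans (min_le_right _ _))
  have hn₃ : n ≤ d₃ := (min_le_left _ _).trans ((min_le_right _ _).trans (min_le_left _ _))
  have hn₄ : n ≤ d₄ := (min_le_left _ _).trans ((min_le_right _ _).trans (min_le_right _ _))
  have hn₅ : n ≤ d₅ := (min_le_right _ _).trans (min_le_left _ _)
  have hnμ : n ≤ μ / 4 := (min_le_right _ _).trans ((min_le_right _ _).trans (min_le_left _ _))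
  have hnθ : n ≤ θ₀ / 2 := (min_le_right _ _).trans ((min_le_right _ _).trans (min_le_right _ _))
  set D : ℝ := 2 * (T + 1) + C₀ + 1 with hD
  have hD1 : 1 ≤ D := by simp only [hD]; linarith
  have hDpos : 0 < D := by linarith
  have hδn : n / D ≤ n := div_le_self hnpos.le hD1
  have key : ∀ {r a : ℝ}, 0 ≤ r → r ≤ D → n ≤ a → n / D * r ≤ a := fun {r a} hr hrD hna => by
    calc n / D * r ≤ n / D * D := mul_le_mul_of_nonneg_left hrD (div_nonneg hnpos.le hDpos.le)
      _ = n := div_mul_cancel₀ n hDpos.ne'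
      _ ≤ a := hna
  refine ⟨n / D, div_pos hnpos hDpos, hδn.trans hn₁, hδn.trans hn₂, hδn.trans hn₃, hδn.trans hn₄,
    hδn.trans hn₅, ?_, ?_⟩
  · exact key (by positivity) (by simp only [hD]; linarith) hnμ
  · exact key (by positivity) (by simp only [hD]; linarith) hnθ

/-- Projection of a clamped time onto `[0,T]`: for `κ ∈ [-ε, T+ε]`, `ε ≥ 0`, the point
`π = max 0 (min T κ) ∈ [0,T]` satisfies `|κ - π| ≤ ε`. [folklore] -/
theorem abs_sub_proj_le {T ε κ : ℝ} (hT : 0 ≤ T) (hε : 0 ≤ ε) (hκ : κ ∈ Icc (-ε) (T + ε)) :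
    max 0 (min T κ) ∈ Icc (0 : ℝ) T ∧ |κ - max 0 (min T κ)| ≤ ε := by
  refine ⟨⟨le_max_left _ _, max_le hT (min_le_left _ _)⟩, ?_⟩
  have h1 := hκ.1
  have h2 := hκ.2
  rcases le_or_gt κ T with h | h
  · rw [min_eq_right h]
    rcases le_or_gt 0 κ with h' | h'
    · rw [max_eq_right h', sub_self, abs_zero]; linarith
    · rw [max_eq_left h'.le, sub_zero, abs_of_neg h']; linarith
  · rw [min_eq_left h.le, max_eq_right hT, abs_of_pos (by linarith)]; linarith

/-- **Lemma 4.1 (Ożański 2017; Scheffer 1985, Lemma 3.1).** Every geometric arrangement admits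
`δ > 0` and profiles `h_{1,t}, h_{2,t}` ((4.9), here for all real `t` through a smooth clamp of
time equal to the identity on `[0,T]`) with: `(b vᵢ, h_{i,t}, ψᵢ)` structures on `Uᵢ` for all
`t` and `|b| ≤ 1` ((4.10), (4.13); via the perturbation criteria `crit₁`, `crit₂`, which moreover
cover the later profiles `qᵏ_{i,t}`), `h_{2,t} > |v₂|` on `{φ₂ = 1}`, and the gain (4.11) with the
margin `θ` of (4.8). [cite: Ozanski2017NSISingular, Lemma 4.1] [cite: Scheffer1985, Lemma 3.1] -/
theorem IsNSIArrangement.exists_hProfileData {U₁ U₂ : Set (ℝ × ℝ)} {v₁ : ℝ × ℝ → ℝ × ℝ}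
    {f₁ φ₁ : ℝ × ℝ → ℝ} {v₂ : ℝ × ℝ → ℝ × ℝ} {f₂ φ₂ : ℝ × ℝ → ℝ} {T τ : ℝ} {z : ℝ³}
    (hA : IsNSIArrangement U₁ U₂ v₁ f₁ φ₁ v₂ f₂ φ₂ T τ z) :
    ∃ (δ : ℝ) (κ : ℝ → ℝ) (ψ₁ ψ₂ : ℝ × ℝ → ℝ) (m₁ m₂ θ : ℝ),
      IsHProfileData U₁ U₂ v₁ v₂ f₁ φ₁ f₂ φ₂ T τ z δ κ ψ₁ ψ₂ m₁ m₂ θ := by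
  have h₁S := hA.structure₁
  have h₂S := hA.structure₂
  have hT := hA.T_pos
  -- the constants of the two structures and of the arrangement
  obtain ⟨d₁, hd₁, ψ₁, hcrit₁⟩ := h₁S.exists_dampedCriterion hT
  obtain ⟨d₂, hd₂, ψ₂, hcrit₂⟩ := h₂S.exists_dampedCriterion hT
  obtain ⟨m₁, hm₁, g₁, hg₁, hgap₁⟩ := h₁S.exists_dampedProfile_gap hT
  obtain ⟨m₂, hm₂, g₂, hg₂, hgap₂⟩ := h₂S.exists_dampedProfile_gap hT
  obtain ⟨s₁, hs₁, hsm₁⟩ := h₁S.exists_contDiffOn_dampedProfile hT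
  obtain ⟨K, hK0, hK⟩ := exists_planePressure_sub_le U₁
  obtain ⟨B₁, B₂, hB₁0, hB₂0, hB₁, hB₂⟩ := exists_fderiv_bounds h₁S.φ_smooth h₁S.isCompact_tsupport_φ
  obtain ⟨V, hV0, hV⟩ := h₂S.exists_abs_v_le
  obtain ⟨M, hM0, hM⟩ := hA.exists_abs_interaction_le
  obtain ⟨μ, hμ, hμle⟩ := hA.exists_interaction_gap
  obtain ⟨θ₀, hθ₀, hθle⟩ := hA.exists_gain_margin
  -- the clamp with overshoot `ε ≤ 1/2`, `εM ≤ μ/2`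
  obtain ⟨ε, hεpos, hε1, hεM⟩ := exists_overshoot hμ hM0
  obtain ⟨κ, hκs, hκid, hκmem, hκd, hκd1⟩ := exists_smooth_clamp hT hεpos
  have hκmem' : ∀ t, κ t ∈ Icc (-(1 / 2) : ℝ) (T + 1 / 2) := fun t =>
    ⟨by linarith [(hκmem t).1], by linarith [(hκmem t).2]⟩
  have hκIcc : ∀ t, κ t ∈ Icc (-1 : ℝ) (T + 1) := fun t =>
    ⟨by linarith [(hκmem t).1], by linarith [(hκmem t).2]⟩
  have hκIoo : ∀ t, κ t ∈ Ioo (-1 : ℝ) (T + 1) := fun t =>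
    ⟨by linarith [(hκmem t).1], by linarith [(hκmem t).2]⟩
  have hκT : ∀ t, |κ t| ≤ T + 1 := fun t => abs_le.2 ⟨by linarith [(hκIcc t).1], (hκIcc t).2⟩
  -- the error constant `C₀`: `|h²_{2,t} - (…)| ≤ δ C₀`
  set C₀ : ℝ := (T + 1) * (V * (2 * (K * (2 * (T + 1) * (B₁ + B₂))))) with hC₀
  have hC₀0 : 0 ≤ C₀ := by positivity
  -- the slack
  obtain ⟨δ, hδpos, hδ₁, hδ₂, hδ₃, hδ₄, hδ₅, hδμ, hδθ⟩ :=
    exists_slack (C₀ := C₀) hT hd₁ hd₂ hg₁ hg₂ hs₁ hμ hθ₀ hC₀0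
  -- everything at the slack `δ`
  have hcrit₁' : DampedCriterion U₁ v₁ f₁ φ₁ ψ₁ δ T := hcrit₁ δ ⟨hδpos.le, hδ₁⟩
  have hcrit₂' : DampedCriterion U₂ v₂ f₂ φ₂ ψ₂ δ T := hcrit₂ δ ⟨hδpos.le, hδ₂⟩
  have hgap₁' : ∀ t ∈ Icc (-1 : ℝ) (T + 1), ∀ q ∈ tsupport φ₁,
      (v₁ q).1 ^ 2 + (v₁ q).2 ^ 2 + m₁ ≤ f₁ q ^ 2 - 2 * t * δ * φ₁ q := hgap₁ δ ⟨hδpos.le, hδ₃⟩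
  have hgap₂' : ∀ t ∈ Icc (-1 : ℝ) (T + 1), ∀ q ∈ tsupport φ₂,
      (v₂ q).1 ^ 2 + (v₂ q).2 ^ 2 + m₂ ≤ f₂ q ^ 2 - 2 * t * δ * φ₂ q := hgap₂ δ ⟨hδpos.le, hδ₄⟩
  have hsm₁' := hsm₁ δ ⟨hδpos.le, hδ₅⟩
  -- `h₁` structures, the rate, the radicand estimate
  have hh₁ : ContDiff ℝ ∞ (uncurry (hProfile₁ f₁ φ₁ δ κ)) := contDiff_hProfile₁ hsm₁' hκs hκIoo
  have hstr₁ : ∀ t, ∀ b : ℝ, |b| ≤ 1 → IsNSIStructure U₁ (b • v₁) (hProfile₁ f₁ φ₁ δ κ t) ψ₁ :=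
    fun t b hb => isNSIStructure_hProfile₁ hcrit₁' hgap₁' hm₁ hh₁ hκIcc t hb
  have hstr₁one : ∀ t, IsNSIStructure U₁ v₁ (hProfile₁ f₁ φ₁ δ κ t) ψ₁ := fun t => by
    simpa using hstr₁ t 1 (by norm_num)
  have hΓ : ContDiff ℝ ∞ (uncurry (interactionRate v₁ v₂ f₁ φ₁ δ κ)) :=
    contDiff_interactionRate h₁S h₂S.v_smooth hh₁ hstr₁one
  have hest : ∀ t q, |hRadicand₂ v₁ v₂ f₁ φ₁ f₂ φ₂ δ κ t q -
      (f₂ q ^ 2 - 2 * κ t * δ * φ₂ q + κ t * ((v₂ q).1 * (pressureInteraction v₁ f₁ q).1 +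
        (v₂ q).2 * (pressureInteraction v₁ f₁ q).2))| ≤ δ * C₀ := by
    intro t q
    have h := abs_hRadicand₂_sub_le (f₂ := f₂) (φ₂ := φ₂) h₁S hgap₁' hm₁ hκIcc hstr₁ hK0 hK hB₁0
      hB₂0 hB₁ hB₂ hV hδpos.le hT hΓ.continuous t q
    refine h.trans ?_
    have e : |κ t| * (V * (2 * (K * (2 * δ * (T + 1) * (B₁ + B₂))))) =
        δ * (|κ t| * (V * (2 * (K * (2 * (T + 1) * (B₁ + B₂)))))) := by ring
    rw [e]
    refine mul_le_mul_of_nonneg_left ?_ hδpos.le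
    exact mul_le_mul_of_nonneg_right (hκT t) (by positivity)
  -- the main term through the clamp: `A₀(κ(t), q) ≥ μ - εM ≥ μ/2` on `supp φ₂`
  have hmain : ∀ t, ∀ q ∈ tsupport φ₂, μ / 2 ≤ f₂ q ^ 2 - ((v₂ q).1 ^ 2 + (v₂ q).2 ^ 2) +
      κ t * ((v₂ q).1 * (pressureInteraction v₁ f₁ q).1 +
        (v₂ q).2 * (pressureInteraction v₁ f₁ q).2) := by
    intro t q hq
    obtain ⟨hπmem, hπd⟩ := abs_sub_proj_le hT.le hεpos.le (hκmem t)
    have hA₀ := hμle _ hπmem q hq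
    have hdiff : |(κ t - max 0 (min T (κ t))) * ((v₂ q).1 * (pressureInteraction v₁ f₁ q).1 +
        (v₂ q).2 * (pressureInteraction v₁ f₁ q).2)| ≤ ε * M := by
      rw [abs_mul]
      exact mul_le_mul hπd (hM q) (abs_nonneg _) hεpos.le
    have h1 := (abs_le.1 hdiff).1
    have e : κ t * ((v₂ q).1 * (pressureInteraction v₁ f₁ q).1 +
        (v₂ q).2 * (pressureInteraction v₁ f₁ q).2) =
        max 0 (min T (κ t)) * ((v₂ q).1 * (pressureInteraction v₁ f₁ q).1 +
          (v₂ q).2 * (pressureInteraction v₁ f₁ q).2) +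
        (κ t - max 0 (min T (κ t))) * ((v₂ q).1 * (pressureInteraction v₁ f₁ q).1 +
          (v₂ q).2 * (pressureInteraction v₁ f₁ q).2) := by ring
    rw [e]
    linarith
  -- the core inequality and the gain
  have hcore : ∀ t q, φ₂ q = 1 →
      (v₂ q).1 ^ 2 + (v₂ q).2 ^ 2 < hProfile₂ v₁ v₂ f₁ φ₁ f₂ φ₂ δ κ t q ^ 2 := by
    intro t q hφ
    have hq : q ∈ tsupport φ₂ := mem_tsupport_of_eq_one hφ
    have h1 := (abs_le.1 (hest t q)).1
    have h2 := hmain t q hq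
    have h4 : 2 * κ t * δ ≤ 2 * (T + 1) * δ :=
      mul_le_mul_of_nonneg_right (by linarith [(abs_le.1 (hκT t)).2]) hδpos.le
    rw [hφ, mul_one] at h1
    have hR : (v₂ q).1 ^ 2 + (v₂ q).2 ^ 2 < hRadicand₂ v₁ v₂ f₁ φ₁ f₂ φ₂ δ κ t q := by
      linarith
    exact hR.trans_le (le_sqrt_sq _)
  have hgain : ∀ x ∈ revolve (closure U₁ ∪ closure U₂),
      τ⁻¹ ^ 2 * (f₁ (meridian x) + f₂ (meridian x)) ^ 2 + θ₀ / 2 ≤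
        hProfile₂ v₁ v₂ f₁ φ₁ f₂ φ₂ δ κ T (meridian (τ • x + z)) ^ 2 := by
    intro x hx
    have h1 := (abs_le.1 (hest T (meridian (τ • x + z)))).1
    rw [hκid T ⟨hT.le, le_rfl⟩] at h1
    have h2 := hθle x hx
    have hφy : φ₂ (meridian (τ • x + z)) ≤ 1 := (h₂S.φ_mem _).2
    have h4 : 2 * T * δ * φ₂ (meridian (τ • x + z)) ≤ 2 * T * δ := by
      have := mul_le_mul_of_nonneg_left hφy (by positivity : (0 : ℝ) ≤ 2 * T * δ)
      linarith
    refine le_trans ?_ (le_sqrt_sq _)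
    linarith
  -- assemble
  exact ⟨δ, κ, ψ₁, ψ₂, m₁, m₂, θ₀ / 2,
    { δ_pos := hδpos
      T_pos := hT
      κ_smooth := hκs
      κ_eq := hκid
      deriv_κ_eq := hκd1
      deriv_κ_mem := hκd
      κ_mem := hκmem'
      m₁_pos := hm₁
      m₂_pos := hm₂
      gap₁ := hgap₁'
      gap₂ := hgap₂'
      smooth₁ := hsm₁'
      crit₁ := hcrit₁'
      crit₂ := hcrit₂'
      core₂ := hcore
      θ_pos := by positivity
      gain := hgain }⟩

end Literature.Barriers.NavierStokesRegularity
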